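import Summits.RiemannHypothesis.RiemannHypothesis.Theorems.WeilParityOffLineParityDetectionLocWitness
import Summits.RiemannHypothesis.RiemannHypothesis.Theorems.WeilParityOffLineParityDetectionLocLayers
import Summits.RiemannHypothesis.RiemannHypothesis.Theorems.WeilParityOffLineParityDetectionLocEvenFloor
import Summits.RiemannHypothesis.RiemannHypothesis.Theorems.WeilParityOffLineParityDetectionStubEvenOffLineLowerBound
import Summits.RiemannHypothesis.RiemannHypothesis.Theorems.WeilParityOffLineParityDetectionStubEvenOffLineCauchySchwarz
import Summits.RiemannHypothesis.RiemannHypothesis.Theorems.WeilParityOffLineParityDetectionStubOddOnLineUpperBound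
import Summits.RiemannHypothesis.RiemannHypothesis.Theorems.WeilParityOffLineParityDetectionTrialIntegrals
import Literature.NumberTheory.LFunctions.WeilGroundEnergyParitySplit
import HarnessLib

/-!
# Crux `OffLineParityDetection` (stmt-RiemannHypothesis-15431), line `registered`: stub **LOC**

Route `WeilParity`, crux
`Summit.RiemannHypothesis.RiemannHypothesis.Theses.WeilParity.OffLineParityDetection`, line
`registered`.  This file proves the registered stub `stub_finiteDefectLocalisation` BY NAME with
the registered signature (finite-defect LOCALISATION, RH-free real analysis): if the set `S` of
off-line zeros of `ζ` in the open strip is finite, all offsets are `≤ η₀` (`η₀ > 0`), the top layer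
`T = {ζ = 0, Re = 1/2 + η₀}` is nonempty, and a FIXED smooth profile `f₀` on `[0, ∞)` gains
`≥ (D + δ) ∫ f₀²` against an even danger `≤ D` frequently as `a → ∞`, then at some window `a` an
odd normalised Weil test beats every real even normalised Weil test on `[-a, a]` by a margin.

## Proof (layers of the zero side; all constants independent of `a` and of `D`)

Write `m = riemannZetaZeroOrder`, `z = ρ - 1/2`, `F(ρ) = ∫₀^∞ f₀ e^{-zu}`, `G(ρ) = ∫₀^∞ f₀ e^{zu}`,
`gain(a, f) = Σ_T m Re(e^{2i(Im ρ)a} F_f(ρ)²)`.  By `loc_layers`, `Σ_S Φ = 2 Σ_T Φ + Σ_E Φ` for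
reflection-invariant weights `Φ`, with `E` the zeros of offset `≤ η' < η₀`.

* ODD WITNESS `o(t) = f₀(a - t) - f₀(a + t)` (`loc_oddWitness`: odd, real, on `[-a, a]`,
  `∫|o|² = 2N`, `N = ∫ f₀²`, `∫|o| + ∫|o″| ≤ L`, `ô = e^{za}F - e^{-za}G`).  ODD-ON
  (`stub_oddOnLineUpperBound`) gives `Re Q(o) ≤ L² Z - Σ_S m Re ô²` (`Z = Σ m/(1+γ²)²`); the top
  layer has `Σ_T m Re ô² ≥ e^{2η₀a} gain(a, f₀) - B` and the lower layers
  `Σ_E m Re ô² ≥ -e^{2η'a} B` (`loc_layer_top/low`, `B = Σ_S m (‖F‖ + ‖G‖)²`); the reflected top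
  layer equals the top layer (`Re ô(1-ρ̄)² = Re ô(ρ)²` for real odd `o`).  With the GAIN
  hypothesis, `Re Q(o) ≤ L²Z + 2B + e^{2η'a}B - 2e^{2η₀a}(D + δ)N`.
* EVEN FLOOR: for a real even normalised `e` on `[-a, a]`, EVEN-LOW
  (`stub_evenOffLineLowerBound`) gives `Re Q(e) ≥ Σ_S m Re ê²`; the top layer is
  `≥ -(D/2)e^{2η₀a} - C₄ e^{η₀a}` (`loc_evenTop`, using the DANGER hypothesis on the cut-off
  profile), the reflected one is equal to it, and the lower layers are
  `≥ -2a e^{2η'a} Σ_E m` (`neg_integral_sinh_sq_mul_sin_sq_le`, `trial_threshold_le`).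
* MARGIN: after normalising `o` (`Q(c o) = c² Q(o)`), `Re Q(e) - Re Q(õ) ≥ δ e^{2η₀a} - K₃ e^{η₀a}
  - K₂ a² e^{2η'a} ≥ (δ/2) e^{2η₀a}` once `(4K₃/δ) a² < e^{η₀a}` and `(4K₂/δ) a² < e^{2(η₀-η')a}`
  (`trial_exists_growth`); such `a`, also `≥` the witness radius, exist frequently.
-/

set_option linter.dupNamespace false

noncomputable section

namespace Summit.RiemannHypothesis.RiemannHypothesis.Theorems.WeilParityOffLineParityDetection

open MeasureTheory Set Filter
open scoped ComplexConjugate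
open Literature.NumberTheory.LFunctions
open Summit.RiemannHypothesis.RiemannHypothesis.Theorems.RuelleBandExactFirstBand
  (stub_evenTransfer_conj_weilMellin)

/-- For a real even `e`: `Re ê(1 - ρ̄)² = Re ê(ρ)²` (`ê(1 - s̄) = conj ê(s)`). [folklore] -/
theorem loc_re_sq_weilMellin_reflect_even {e : ℝ → ℂ} (heven : ∀ t, e (-t) = e t)
    (hreal : ∀ t, (e t).im = 0) (ρ : ℂ) :
    ((weilMellin e (1 - conj ρ)) ^ 2).re = ((weilMellin e ρ) ^ 2).re := by
  rw [← stub_evenTransfer_conj_weilMellin heven hreal ρ, ← map_pow, Complex.conj_re]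

/-- For a real odd `o`: `Re ô(1 - ρ̄)² = Re ô(ρ)²`. [folklore] -/
theorem loc_re_sq_weilMellin_reflect_odd {o : ℝ → ℂ} (hodd : ∀ t, o (-t) = -o t)
    (hreal : ∀ t, (o t).im = 0) (ρ : ℂ) :
    ((weilMellin o (1 - conj ρ)) ^ 2).re = ((weilMellin o ρ) ^ 2).re := by
  rw [trial_re_sq_weilMellin_one_sub hodd, trial_re_sq_weilMellin_conj hreal]

/-- Normalisation: for real `c` and any `o`, `∫ |c o|² = c² ∫ |o|²` and `Re Q(c o) = c² Re Q(o)`.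
[folklore] -/
theorem loc_normalise (c : ℝ) (o : ℝ → ℂ) :
    ∫ t, ‖(c : ℂ) * o t‖ ^ 2 = c ^ 2 * ∫ t, ‖o t‖ ^ 2 ∧
      (weilQuadratic fun t ↦ (c : ℂ) * o t).re = c ^ 2 * (weilQuadratic o).re := by
  constructor
  · rw [← integral_const_mul]
    congr 1 with t
    rw [norm_mul, Complex.norm_real, Real.norm_eq_abs, mul_pow, sq_abs]
  · rw [weilQuadratic_const_mul, Complex.re_ofReal_mul, Complex.normSq_ofReal, sq]

/-- The lower even layers: for a real even normalised Weil test `e` on `[-a, a]` (`a ≥ 0`) and a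
point `ρ` of offset `|Re ρ - 1/2| ≤ η'`, `Re ê(ρ)² ≥ -2a e^{2η'a}` (Cauchy–Schwarz threshold
`neg_integral_sinh_sq_mul_sin_sq_le` and `trial_threshold_le`). [folklore] -/
theorem loc_evenLow_pt {a η' : ℝ} (ha : 0 ≤ a) {e : ℝ → ℂ} (he : IsWeilTest e)
    (hsupp : tsupport e ⊆ Icc (-a) a) (heven : ∀ t, e (-t) = e t) (hreal : ∀ t, (e t).im = 0)
    (hnorm : ∫ t, ‖e t‖ ^ 2 = (1 : ℝ)) {ρ : ℂ} (hρ : |ρ.re - 1 / 2| ≤ η') :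
    -(2 * a * Real.exp (2 * η' * a)) ≤ ((weilMellin e ρ) ^ 2).re := by
  have hb1 := neg_integral_sinh_sq_mul_sin_sq_le he hsupp heven hreal hnorm ρ
  have hb2 := trial_threshold_le (ρ.re - 1 / 2) ρ.im ha
  have hb3 : Real.exp (2 * |ρ.re - 1 / 2| * a) ≤ Real.exp (2 * η' * a) :=
    Real.exp_le_exp.2 (by nlinarith [abs_nonneg (ρ.re - 1 / 2)])
  have hb4 := mul_le_mul_of_nonneg_left hb3 (show 0 ≤ 2 * a by positivity)
  linarith

set_option maxHeartbeats 400000 in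
/-- **Stub `stub_finiteDefectLocalisation` (LOC) of crux `OffLineParityDetection`, line
`registered` — registered signature.**  See the module docstring for the statement and the proof.
[folklore] -/
theorem stub_finiteDefectLocalisation :
    ∀ hS : ({ρ : ℂ | riemannZeta ρ = 0 ∧ 0 < ρ.re ∧ ρ.re < 1 ∧ ρ.re ≠ 1 / 2}).Finite,
      ∀ η₀ : ℝ, 0 < η₀ →
      (∀ ρ : ℂ, riemannZeta ρ = 0 → 0 < ρ.re → ρ.re < 1 → ρ.re ≠ 1 / 2 → |ρ.re - 1 / 2| ≤ η₀) →
      ∀ T : Finset ℂ, (∀ ρ : ℂ, ρ ∈ T ↔ (riemannZeta ρ = 0 ∧ ρ.re = 1 / 2 + η₀)) → T.Nonempty →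
      ∀ δ : ℝ, 0 < δ → ∀ f₀ : ℝ → ℝ, ContDiff ℝ (⊤ : ℕ∞) f₀ → HasCompactSupport f₀ →
      tsupport f₀ ⊆ Set.Ici 0 → 0 < ∫ u in Set.Ioi (0 : ℝ), f₀ u ^ 2 →
      (∃ᶠ a : ℝ in Filter.atTop, ∃ D : ℝ, 0 ≤ D ∧
        (∀ f : ℝ → ℝ, ContDiff ℝ (⊤ : ℕ∞) f → HasCompactSupport f → tsupport f ⊆ Set.Ici 0 →
          -(∑ ρ ∈ T, (riemannZetaZeroOrder ρ : ℝ) *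
              (Complex.exp (2 * (ρ.im : ℂ) * (a : ℂ) * Complex.I) *
              (∫ u in Set.Ioi (0 : ℝ), (f u : ℂ) * Complex.exp (-((ρ - 1 / 2) * (u : ℂ)))) ^ 2).re)
            ≤ D * ∫ u in Set.Ioi (0 : ℝ), f u ^ 2) ∧
        (D + δ) * ∫ u in Set.Ioi (0 : ℝ), f₀ u ^ 2 ≤
          ∑ ρ ∈ T, (riemannZetaZeroOrder ρ : ℝ) *
            (Complex.exp (2 * (ρ.im : ℂ) * (a : ℂ) * Complex.I) *
            (∫ u in Set.Ioi (0 : ℝ), (f₀ u : ℂ) * Complex.exp (-((ρ - 1 / 2) * (u : ℂ)))) ^ 2).re) →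
      ∃ a : ℝ, 0 < a ∧ ∃ o : ℝ → ℂ, IsWeilTest o ∧ tsupport o ⊆ Set.Icc (-a) a ∧
        (∀ t, o (-t) = -o t) ∧ ∫ t, ‖o t‖ ^ 2 = (1 : ℝ) ∧ ∃ m : ℝ, 0 < m ∧
        ∀ e : ℝ → ℂ, IsWeilTest e → tsupport e ⊆ Set.Icc (-a) a → (∀ t, e (-t) = e t) →
          (∀ t, (e t).im = 0) → ∫ t, ‖e t‖ ^ 2 = (1 : ℝ) →
          (weilQuadratic o).re + m ≤ (weilQuadratic e).re := by
  intro hS η₀ hη₀ hbound T hTmem hTne δ hδ f₀ hf₀ hf₀c hf₀s hN hfreq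
  classical
  /- (0) DATA independent of the window: layers, witness radius, weights, constants -/
  obtain ⟨N, hN'⟩ : ∃ N : ℝ, N = ∫ u in Set.Ioi (0 : ℝ), f₀ u ^ 2 := ⟨_, rfl⟩
  rw [← hN'] at hN hfreq
  obtain ⟨η', hη'0, hη'lt, E, hE, hT, hEoff, hsplit⟩ := loc_layers hS η₀ hη₀ hbound T hTmem hTne
  obtain ⟨R, L, hR1, hwit⟩ := loc_oddWitness f₀ hf₀ hf₀c hf₀s
  obtain ⟨mw, hmw⟩ : ∃ mw : ℂ → ℝ, ∀ ρ, mw ρ = (riemannZetaZeroOrder ρ : ℝ) := ⟨_, fun _ ↦ rfl⟩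
  simp only [← hmw] at hfreq
  have hmemS : ∀ ρ ∈ hS.toFinset, riemannZeta ρ = 0 ∧ 0 < ρ.re ∧ ρ.re < 1 ∧ ρ.re ≠ 1 / 2 :=
    fun ρ hρ ↦ (Set.Finite.mem_toFinset hS).1 hρ
  have hm0 : ∀ ρ ∈ hS.toFinset, 0 ≤ mw ρ := fun ρ hρ ↦ by
    obtain ⟨-, -, h1, -⟩ := hmemS ρ hρ
    have hne : ρ ≠ 1 := fun h ↦ by rw [h, Complex.one_re] at h1; exact lt_irrefl _ h1
    rw [hmw]
    exact_mod_cast riemannZetaZeroOrder_nonneg hne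
  have hmT : ∀ ρ ∈ T, 0 ≤ mw ρ := fun ρ hρ ↦ hm0 ρ (hT hρ)
  have hmE : ∀ ρ ∈ E, 0 ≤ mw ρ := fun ρ hρ ↦ hm0 ρ (hE hρ)
  have hTre : ∀ ρ ∈ T, ρ.re = 1 / 2 + η₀ := fun ρ hρ ↦ ((hTmem ρ).1 hρ).2
  have hsymm : ∀ ρ ∈ T, mw (1 - conj ρ) = mw ρ := fun ρ hρ ↦ by
    obtain ⟨-, h0, h1, -⟩ := hmemS ρ (hT hρ)
    rw [hmw, hmw, riemannZetaZeroOrder_one_sub_conj h0 h1]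
  -- the two Laplace values of `f₀` at `z = ρ - 1/2` (kept opaque)
  obtain ⟨Fz, hFz⟩ : ∃ Fz : ℂ → ℂ, ∀ ρ, Fz ρ =
      ∫ u in Set.Ioi (0 : ℝ), (f₀ u : ℂ) * Complex.exp (-((ρ - 1 / 2) * (u : ℂ))) :=
    ⟨_, fun _ ↦ rfl⟩
  obtain ⟨Gz, hGz⟩ : ∃ Gz : ℂ → ℂ, ∀ ρ, Gz ρ =
      ∫ u in Set.Ioi (0 : ℝ), (f₀ u : ℂ) * Complex.exp ((ρ - 1 / 2) * (u : ℂ)) :=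
    ⟨_, fun _ ↦ rfl⟩
  simp only [← hFz] at hfreq
  -- constants (kept opaque)
  obtain ⟨Z, hZ⟩ : ∃ Z : ℝ,
      Z = ∑' ρ : ZetaZeros.riemannZetaNontrivialZeros, weilZeroWeight (ρ : ℂ) := ⟨_, rfl⟩
  obtain ⟨B, hB⟩ : ∃ B : ℝ, B = ∑ ρ ∈ hS.toFinset, mw ρ * (‖Fz ρ‖ + ‖Gz ρ‖) ^ 2 := ⟨_, rfl⟩
  obtain ⟨W, hW⟩ : ∃ W : ℝ, W = ∑ ρ ∈ T, mw ρ := ⟨_, rfl⟩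
  obtain ⟨ME, hME⟩ : ∃ ME : ℝ, ME = ∑ ρ ∈ E, mw ρ := ⟨_, rfl⟩
  obtain ⟨C₄, hC₄⟩ : ∃ C₄ : ℝ, C₄ = 3 * ((1 + 1 / η₀) / 2) ^ 2 * Real.exp η₀ * W := ⟨_, rfl⟩
  obtain ⟨K₃, hK₃⟩ : ∃ K₃ : ℝ, K₃ = 2 * C₄ + (L ^ 2 * Z + 2 * B) / (2 * N) := ⟨_, rfl⟩
  obtain ⟨K₂, hK₂⟩ : ∃ K₂ : ℝ, K₂ = 2 * ME + B / (2 * N) := ⟨_, rfl⟩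
  have hZ0 : 0 ≤ Z := by rw [hZ]; exact tsum_nonneg fun ρ ↦ weilZeroWeight_nonneg ρ.2
  have hB0 : 0 ≤ B := by
    rw [hB]; exact Finset.sum_nonneg fun ρ hρ ↦ mul_nonneg (hm0 ρ hρ) (sq_nonneg _)
  have hW0 : 0 ≤ W := by rw [hW]; exact Finset.sum_nonneg hmT
  have hME0 : 0 ≤ ME := by rw [hME]; exact Finset.sum_nonneg hmE
  have hC₄0 : 0 ≤ C₄ := by rw [hC₄]; positivity
  have hK₃0 : 0 ≤ K₃ := by rw [hK₃]; positivity
  have hK₂0 : 0 ≤ K₂ := by rw [hK₂]; positivity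
  have hBT : ∑ ρ ∈ T, mw ρ * (‖Fz ρ‖ + ‖Gz ρ‖) ^ 2 ≤ B := by
    rw [hB]
    exact Finset.sum_le_sum_of_subset_of_nonneg hT fun ρ hρ _ ↦
      mul_nonneg (hm0 ρ hρ) (sq_nonneg _)
  have hBE : ∑ ρ ∈ E, mw ρ * (‖Fz ρ‖ + ‖Gz ρ‖) ^ 2 ≤ B := by
    rw [hB]
    exact Finset.sum_le_sum_of_subset_of_nonneg hE fun ρ hρ _ ↦
      mul_nonneg (hm0 ρ hρ) (sq_nonneg _)
  /- (1) THRESHOLDS and the choice of the window `a` -/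
  obtain ⟨A₁, hA₁⟩ := trial_exists_growth hη₀ (4 * K₃ / δ)
  have hgap : 0 < 2 * (η₀ - η') := by linarith
  obtain ⟨A₂, hA₂⟩ := trial_exists_growth hgap (4 * K₂ / δ)
  obtain ⟨a, ha, D, hD, hdanger, hgain⟩ :=
    hfreq.forall_exists_of_atTop (max (max R 1) (max A₁ A₂))
  have haR : R ≤ a := le_trans (le_max_left _ _) (le_trans (le_max_left _ _) ha)
  have ha1 : 1 ≤ a := le_trans (le_max_right _ _) (le_trans (le_max_left _ _) ha)
  have haA₁ : A₁ ≤ a := le_trans (le_max_left _ _) (le_trans (le_max_right _ _) ha)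
  have haA₂ : A₂ ≤ a := le_trans (le_max_right _ _) (le_trans (le_max_right _ _) ha)
  have ha0 : 0 ≤ a := by linarith
  obtain ⟨E2, hE2⟩ : ∃ E2 : ℝ, E2 = Real.exp (2 * η₀ * a) := ⟨_, rfl⟩
  obtain ⟨E1, hE1⟩ : ∃ E1 : ℝ, E1 = Real.exp (η₀ * a) := ⟨_, rfl⟩
  obtain ⟨Eη, hEη⟩ : ∃ Eη : ℝ, Eη = Real.exp (2 * η' * a) := ⟨_, rfl⟩
  have hE2pos : 0 < E2 := by rw [hE2]; exact Real.exp_pos _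
  have hE1pos : 0 < E1 := by rw [hE1]; exact Real.exp_pos _
  have hEηpos : 0 < Eη := by rw [hEη]; exact Real.exp_pos _
  have hE11 : 1 ≤ E1 := by rw [hE1]; exact Real.one_le_exp (by positivity)
  have hE1sq : E1 * E1 = E2 := by rw [hE1, hE2, ← Real.exp_add]; congr 1; ring
  have ha2 : 1 ≤ a ^ 2 := by nlinarith
  have haa : a ≤ a ^ 2 := by nlinarith
  -- `K₃ E1 ≤ (δ/4) E2` and `K₂ a² Eη ≤ (δ/4) E2`
  have hth1 : K₃ * E1 ≤ δ / 4 * E2 := by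
    have h1 := hA₁ a haA₁
    rw [← hE1] at h1
    have h2 : 4 * K₃ / δ ≤ 4 * K₃ / δ * a ^ 2 := le_mul_of_one_le_right (by positivity) ha2
    have h4 : K₃ ≤ δ / 4 * E1 := by
      have := mul_le_mul_of_nonneg_left (h2.trans h1.le) (show (0 : ℝ) ≤ δ / 4 by positivity)
      rwa [show δ / 4 * (4 * K₃ / δ) = K₃ by field_simp] at this
    calc K₃ * E1 ≤ δ / 4 * E1 * E1 := mul_le_mul_of_nonneg_right h4 hE1pos.le
      _ = δ / 4 * E2 := by rw [mul_assoc, hE1sq]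
  have hth2 : K₂ * a ^ 2 * Eη ≤ δ / 4 * E2 := by
    have h1 := hA₂ a haA₂
    have h4 : K₂ * a ^ 2 ≤ δ / 4 * Real.exp (2 * (η₀ - η') * a) := by
      have := mul_le_mul_of_nonneg_left h1.le (show (0 : ℝ) ≤ δ / 4 by positivity)
      rwa [show δ / 4 * (4 * K₂ / δ * a ^ 2) = K₂ * a ^ 2 by field_simp] at this
    have h5 : Real.exp (2 * (η₀ - η') * a) * Eη = E2 := by
      rw [hEη, hE2, ← Real.exp_add]; congr 1; ring
    calc K₂ * a ^ 2 * Eη ≤ δ / 4 * Real.exp (2 * (η₀ - η') * a) * Eη :=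
          mul_le_mul_of_nonneg_right h4 hEηpos.le
      _ = δ / 4 * E2 := by rw [mul_assoc, h5]
  /- (2) THE ODD WITNESS at the window `a` -/
  obtain ⟨o, ho⟩ : ∃ o : ℝ → ℂ, ∀ t, o t = ((f₀ (a - t) - f₀ (a + t) : ℝ) : ℂ) := ⟨_, fun _ ↦ rfl⟩
  obtain ⟨hoW, hosupp, hodd, horeal, honorm, hoL, hotrans⟩ := hwit a haR o ho
  have htrans : ∀ ρ : ℂ, weilMellin o ρ =
      Complex.exp ((ρ - 1 / 2) * (a : ℂ)) * Fz ρ - Complex.exp (-((ρ - 1 / 2) * (a : ℂ))) * Gz ρ :=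
    fun ρ ↦ by rw [hFz, hGz]; exact hotrans ρ
  -- ODD-ON and the layers of `Σ_S m Re ô²`
  have hQo : (weilQuadratic o).re ≤ L ^ 2 * Z + 2 * B + Eη * B - 2 * (E2 * ((D + δ) * N)) := by
    have h1 := stub_oddOnLineUpperBound o hoW hodd horeal hS
    simp only [← hmw] at h1
    rw [← hZ] at h1
    have hLo : 0 ≤ (∫ t, ‖o t‖) + ∫ t, ‖deriv (deriv o) t‖ :=
      add_nonneg (integral_nonneg fun _ ↦ norm_nonneg _) (integral_nonneg fun _ ↦ norm_nonneg _)
    have hL2 : ((∫ t, ‖o t‖) + ∫ t, ‖deriv (deriv o) t‖) ^ 2 * Z ≤ L ^ 2 * Z :=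
      mul_le_mul_of_nonneg_right (pow_le_pow_left₀ hLo hoL 2) hZ0
    have h2 : ∑ ρ ∈ hS.toFinset, mw ρ * ((weilMellin o ρ) ^ 2).re =
        2 * ∑ ρ ∈ T, mw ρ * ((weilMellin o ρ) ^ 2).re +
          ∑ ρ ∈ E, mw ρ * ((weilMellin o ρ) ^ 2).re :=
      hsplit (fun ρ ↦ mw ρ * ((weilMellin o ρ) ^ 2).re) fun ρ hρ ↦ by
        rw [hsymm ρ hρ, loc_re_sq_weilMellin_reflect_odd hodd horeal]
    have h3 := loc_layer_top T mw η₀ a hη₀.le ha0 hTre hmT (weilMellin o) Fz Gz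
      fun ρ _ ↦ htrans ρ
    rw [← hE2] at h3
    have h4 := loc_layer_low E mw η' a hη'0 ha0 hEoff hmE (weilMellin o) Fz Gz fun ρ _ ↦ htrans ρ
    rw [← hEη] at h4
    have h5 := mul_le_mul_of_nonneg_left hgain hE2pos.le
    have h6 := mul_le_mul_of_nonneg_left hBE hEηpos.le
    linarith [h1, hL2, h2, h3, h4, h5, h6, hBT]
  -- normalisation `õ = o / √(2N)`
  obtain ⟨c, hc⟩ : ∃ c : ℝ, c = (Real.sqrt (2 * N))⁻¹ := ⟨_, rfl⟩
  have hc2 : c ^ 2 * (2 * N) = 1 := by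
    rw [hc, inv_pow, Real.sq_sqrt (by positivity), inv_mul_cancel₀ (by positivity)]
  obtain ⟨hõnorm, hõQ⟩ := loc_normalise c o
  refine ⟨a, by linarith, fun t ↦ (c : ℂ) * o t, hoW.const_mul _,
    loc_tsupport_subset isClosed_Icc fun t ht ↦ ?_, fun t ↦ ?_, ?_,
    δ / 2 * E2, by positivity, fun e he hesupp hev hereal henorm ↦ ?_⟩
  · rw [image_eq_zero_of_notMem_tsupport fun h ↦ ht (hosupp h), mul_zero]
  · show (c : ℂ) * o (-t) = -((c : ℂ) * o t)
    rw [hodd, mul_neg]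
  · rw [hõnorm, honorm, ← hN', hc2]
  /- (3) THE EVEN FLOOR and the margin -/
  have hQe : -(D * E2) - 2 * (C₄ * E1) - 2 * a * Eη * ME ≤ (weilQuadratic e).re := by
    have h1 := stub_evenOffLineLowerBound e he hev hereal hS
    simp only [← hmw] at h1
    have h2 : ∑ ρ ∈ hS.toFinset, mw ρ * ((weilMellin e ρ) ^ 2).re =
        2 * ∑ ρ ∈ T, mw ρ * ((weilMellin e ρ) ^ 2).re +
          ∑ ρ ∈ E, mw ρ * ((weilMellin e ρ) ^ 2).re :=
      hsplit (fun ρ ↦ mw ρ * ((weilMellin e ρ) ^ 2).re) fun ρ hρ ↦ by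
        rw [hsymm ρ hρ, loc_re_sq_weilMellin_reflect_even hev hereal]
    have h3 := loc_evenTop η₀ hη₀ T hTre mw hmT a D ha1 hD hdanger e he hesupp hev hereal henorm
    rw [← hE2, ← hE1, ← hW, ← hC₄] at h3
    have h4 : ∑ ρ ∈ E, mw ρ * (-(2 * a * Eη)) ≤ ∑ ρ ∈ E, mw ρ * ((weilMellin e ρ) ^ 2).re := by
      refine Finset.sum_le_sum fun ρ hρ ↦ mul_le_mul_of_nonneg_left ?_ (hmE ρ hρ)
      rw [hEη]
      exact loc_evenLow_pt ha0 he hesupp hev hereal henorm (hEoff ρ hρ)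
    rw [← Finset.sum_mul, ← hME] at h4
    linarith [h1, h2, h3, h4]
  -- the margin
  have hkey : (weilQuadratic o).re ≤ 2 * N * ((weilQuadratic e).re - δ / 2 * E2) := by
    have h6 : L ^ 2 * Z + 2 * B ≤ (L ^ 2 * Z + 2 * B) * E1 :=
      le_mul_of_one_le_right (by positivity) hE11
    have h7 : Eη * B ≤ a ^ 2 * (Eη * B) := le_mul_of_one_le_left (by positivity) ha2
    have h8 : a * (Eη * ME) ≤ a ^ 2 * (Eη * ME) := mul_le_mul_of_nonneg_right haa (by positivity)
    have h8' := mul_le_mul_of_nonneg_left h8 (show (0 : ℝ) ≤ 4 * N by positivity)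
    have h9 : 2 * N * K₃ = 4 * N * C₄ + (L ^ 2 * Z + 2 * B) := by
      rw [hK₃]; field_simp; ring
    have h9' : 2 * N * (K₃ * E1) = (4 * N * C₄ + (L ^ 2 * Z + 2 * B)) * E1 := by
      rw [← h9]; ring
    have h10 : 2 * N * K₂ = 4 * N * ME + B := by
      rw [hK₂]; field_simp; ring
    have h10' : 2 * N * (K₂ * a ^ 2 * Eη) = (4 * N * ME + B) * (a ^ 2 * Eη) := by
      rw [show 2 * N * (K₂ * a ^ 2 * Eη) = 2 * N * K₂ * (a ^ 2 * Eη) by ring, h10]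
    have h11 := mul_le_mul_of_nonneg_left hth1 (show (0 : ℝ) ≤ 2 * N by positivity)
    have h12 := mul_le_mul_of_nonneg_left hth2 (show (0 : ℝ) ≤ 2 * N by positivity)
    have h13 := mul_le_mul_of_nonneg_left hQe (show (0 : ℝ) ≤ 2 * N by positivity)
    linarith [hQo, h13, h6, h7, h8', h9', h10', h11, h12]
  rw [hõQ]
  have h2N : (0 : ℝ) < 2 * N := by positivity
  have hc2' : c ^ 2 = 1 / (2 * N) := by rw [eq_div_iff h2N.ne']; exact hc2
  have hdiv : (weilQuadratic o).re / (2 * N) ≤ (weilQuadratic e).re - δ / 2 * E2 :=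
    (div_le_iff₀ h2N).2 (by linarith [hkey])
  rw [hc2', one_div_mul_eq_div]
  linarith [hdiv]

end Summit.RiemannHypothesis.RiemannHypothesis.Theorems.WeilParityOffLineParityDetection

end
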